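import Mathlib
import HarnessLib
import Summits.NavierStokesRegularity.NavierStokesRegularity.Theorems.PlaneStrainDoorProfileEnstrophyLiouville
import Summits.NavierStokesRegularity.NavierStokesRegularity.Theorems.FrobeniusProfileRigidity.Negative.LoadBearing

/-!
# nsreg-p1 ROUND-15: the three PROFILE LIOUVILLE theorems of the planned doors S16 «production-free window»,
# S16′ «plane-strain window», S16γ «tube strain» — PROVED

The texts of nsreg-p1 `r15/Sketch16.lean` (`ProductionFreeProfileLiouville`, `PlaneStrainProfileLiouville`,
`TubeStrainProfileLiouville`, `TubeStrainLiouvilleCore`, `TubeStrainProfileRigidity`), with the sketch's abbreviations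
`stretchF A = ⟪curlCLM A, A (curlCLM A)⟫`, `strainDet A = (A + A†).det`, `MidStrainMajorant A m` (two-frame
Courant–Fischer form) UNFOLDED, all as instances of ONE engine
(`PlaneStrainDoorProfileEnstrophyLiouville.eq_zero_of_integral_inner_laplacian_convect_nonpos`: a door-class profile
with space–time Type-I decay and non-positive trilinear enstrophy production on every slice vanishes identically)
through Betchov's three sign rules (`MillerEnstrophyProductionIdentity`):

* `productionFreeProfileLiouville` — `ω·Sω ≡ 0` on every slice ⇒ `v ≡ 0`;
* `planeStrainProfileLiouville` — `det (∇v + ∇vᵀ) ≡ 0` on every slice ⇒ `v ≡ 0`;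
* `tubeStrainProfileLiouville` — `λ₂(∇v(s,y)) ≤ 0` for all `s < 0`, `y ≠ 0` ⇒ `v ≡ 0` (at `y = 0` by continuity of
  `λ₂ ∘ ∇v(s)`); `tubeStrainLiouvilleCore` (the same with the now-redundant derivative-decay hypothesis) and
  `tubeStrainProfileRigidity` (`¬ IsBackwardSingularPoint v 0`).

With the sketch's PROVED assemblies (`targetTubeStrain_of_rigidity`, `tubeStrainRigidity_of_liouville`,
`closes_tubeStrain`) door S16γ `TargetTubeStrain` is thereby a theorem modulo transcription; S16/S16′ need in
addition the window-to-slab step (`WindowToSlab stretchF/strainDet`, slice analyticity) for their window forms.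
Seat nsreg-p6 g8.  WHAT THIS IS NOT: not NS regularity (Clay A), not the Type-I Liouville conjecture
(`TypeIliouvilleL`) — Liouville theorems for the door class UNDER a pointwise sign structure of the strain; not a
route open.
-/

noncomputable section

open MeasureTheory Set Function Filter Topology InnerProductSpace
open scoped ENNReal NNReal RealInnerProductSpace Laplacian ContDiff
open Literature.Analysis Literature.Analysis.FluidPDE
open Summit.NavierStokesRegularity.NavierStokesRegularity.Theorems.PlaneStrainDoorProfileGradientDecay
open Summit.NavierStokesRegularity.NavierStokesRegularity.Theorems.PlaneStrainDoorProfileWeights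
open Summit.NavierStokesRegularity.NavierStokesRegularity.Theorems.PlaneStrainDoorProfileEnstrophyLiouville
open Summit.NavierStokesRegularity.NavierStokesRegularity.Theorems.FrobeniusProfileRigidity.Negative

-- the summit and its single sub-problem share the name (CONVENTIONS §1), as in every Theorems file
set_option linter.dupNamespace false

namespace Summit.NavierStokesRegularity.NavierStokesRegularity.Theorems.PlaneStrainDoorProfileLiouvilles

variable {C D : ℝ} {v : ℝ → EuclideanSpace ℝ (Fin 3) → EuclideanSpace ℝ (Fin 3)}

/-- Slice bookkeeping for the sign rules: each slice of a classical profile with the scale-invariant bounds is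
smooth, divergence free, bounded with bounded gradient, and has `Dv, D²v ∈ L²`. -/
theorem slice_data {q : ℝ → EuclideanSpace ℝ (Fin 3) → ℝ} (hcl : IsClassicalNSSolutionOn (Iio 0) 1 0 v q)
    (hrate : HasTypeITimeDecay C v) {K : ℝ}
    (hK : ∀ t < (0 : ℝ), ∀ x : EuclideanSpace ℝ (Fin 3),
        (‖x‖ + Real.sqrt (-t)) * ‖v t x‖ ≤ K ∧
        (‖x‖ + Real.sqrt (-t)) ^ 2 * ‖fderiv ℝ (v t) x‖ ≤ K ∧
        (‖x‖ + Real.sqrt (-t)) ^ 3 * ‖iteratedFDeriv ℝ 2 (v t) x‖ ≤ K ∧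
        (‖x‖ + Real.sqrt (-t)) ^ 4 * ‖iteratedFDeriv ℝ 3 (v t) x‖ ≤ K ∧
        (‖x‖ + Real.sqrt (-t)) ^ 2 * |q t x| ≤ K ∧
        (‖x‖ + Real.sqrt (-t)) ^ 3 * ‖gradient (q t) x‖ ≤ K ∧
        (‖x‖ + Real.sqrt (-t)) ^ 3 * ‖timeDeriv v t x‖ ≤ K ∧
        (‖x‖ + Real.sqrt (-t)) ^ 4 * ‖fderiv ℝ (timeDeriv v t) x‖ ≤ K)
    {s : ℝ} (hs : s < 0) :
    ContDiff ℝ ∞ (v s) ∧ VectorCalculus.IsDivFree (v s) ∧ (∀ x, ‖v s x‖ ≤ C / Real.sqrt (-s)) ∧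
      (∀ x, ‖fderiv ℝ (v s) x‖ ≤ K / Real.sqrt (-s) ^ 2) ∧
      ∫⁻ x, ‖iteratedFDeriv ℝ 1 (v s) x‖ₑ ^ 2 < ⊤ ∧ ∫⁻ x, ‖iteratedFDeriv ℝ 2 (v s) x‖ₑ ^ 2 < ⊤ := by
  have ha : 0 < Real.sqrt (-s) := Real.sqrt_pos.2 (by linarith)
  refine ⟨hcl.contDiff_velocity hs, hcl.divFree s hs, fun x => hrate s hs x, fun x => ?_, ?_, ?_⟩
  · have h := (hK s hs x).2.1
    have hxa : 0 < (‖x‖ + Real.sqrt (-s)) ^ 2 := by positivity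
    rw [le_div_iff₀ (pow_pos ha 2)]
    calc ‖fderiv ℝ (v s) x‖ * Real.sqrt (-s) ^ 2 ≤ ‖fderiv ℝ (v s) x‖ * (‖x‖ + Real.sqrt (-s)) ^ 2 :=
          mul_le_mul_of_nonneg_left (pow_le_pow_left₀ ha.le (by linarith [norm_nonneg x]) 2) (norm_nonneg _)
      _ ≤ K := by rw [mul_comm]; exact h
  · exact lintegral_enorm_sq_lt_top_of_weight_le ha (m := 2) le_rfl fun x => by
      rw [norm_iteratedFDeriv_one]; exact (hK s hs x).2.1
  · exact lintegral_enorm_sq_lt_top_of_weight_le ha (m := 3) (by norm_num) fun x => (hK s hs x).2.2.1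

/-- **support · «production-free profile LIOUVILLE»** (text of nsreg-p1 `r15/Sketch16.lean`
`ProductionFreeProfileLiouville`, `stretchF` unfolded): a door-class profile with space–time Type-I decay whose
enstrophy production density `ω·Sω = ⟪curl ∇v, ∇v (curl ∇v)⟫` vanishes at every point of every slice is zero. -/
theorem productionFreeProfileLiouville :
    ∀ (C D : ℝ) (v : ℝ → EuclideanSpace ℝ (Fin 3) → EuclideanSpace ℝ (Fin 3)),
    HasTypeITimeDecay C v →
    HasTypeIDecay D v →
    ContinuousOn (Function.uncurry v) (Set.Iio (0 : ℝ) ×ˢ Set.univ) →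
    (∀ s t : ℝ, s < t → t < 0 → ∀ x, v t x =
      UnboundedOperators.heatExtension (v s) (t - s) x - oseenDuhamel 1 s v v t x) →
    (∀ t < 0, VectorCalculus.IsDivFree (v t)) →
    (∀ s < 0, ∀ z, inner ℝ (curlCLM (fderiv ℝ (v s) z)) ((fderiv ℝ (v s) z) (curlCLM (fderiv ℝ (v s) z))) = 0) →
    ∀ s < 0, ∀ z, v s z = 0 := by
  intro C D v hrate hdec hcont hmild hdiv hprod
  obtain ⟨q, K, hcl, -, hK⟩ := exists_classical_scaleInvariantBounds hrate hdec hcont hmild hdiv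
  refine eq_zero_of_integral_inner_laplacian_convect_nonpos hrate hdec hcont hmild hdiv fun s hs => le_of_eq ?_
  obtain ⟨hsm, hdv, hB, hB₁, hv1, hv2⟩ := slice_data hcl hrate hK hs
  exact integral_inner_laplacian_convect_eq_zero_of_stretching_eq_zero hsm hdv hB hB₁ hv1 hv2
    fun x => by rw [curl_eq_curlCLM]; exact hprod s hs x

/-- **support′ · «plane-strain profile LIOUVILLE»** (text of nsreg-p1 `r15/Sketch16.lean` `PlaneStrainProfileLiouville`,
`strainDet` unfolded): a door-class profile with space–time Type-I decay with Betchov's invariant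
`det (∇v + ∇vᵀ) = 0` at every point of every slice is zero. -/
theorem planeStrainProfileLiouville :
    ∀ (C D : ℝ) (v : ℝ → EuclideanSpace ℝ (Fin 3) → EuclideanSpace ℝ (Fin 3)),
    HasTypeITimeDecay C v →
    HasTypeIDecay D v →
    ContinuousOn (Function.uncurry v) (Set.Iio (0 : ℝ) ×ˢ Set.univ) →
    (∀ s t : ℝ, s < t → t < 0 → ∀ x, v t x =
      UnboundedOperators.heatExtension (v s) (t - s) x - oseenDuhamel 1 s v v t x) →
    (∀ t < 0, VectorCalculus.IsDivFree (v t)) →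
    (∀ s < 0, ∀ z, (fderiv ℝ (v s) z + ContinuousLinearMap.adjoint (fderiv ℝ (v s) z)).det = 0) →
    ∀ s < 0, ∀ z, v s z = 0 := by
  intro C D v hrate hdec hcont hmild hdiv hdet
  obtain ⟨q, K, hcl, -, hK⟩ := exists_classical_scaleInvariantBounds hrate hdec hcont hmild hdiv
  refine eq_zero_of_integral_inner_laplacian_convect_nonpos hrate hdec hcont hmild hdiv fun s hs => le_of_eq ?_
  obtain ⟨hsm, hdv, hB, hB₁, hv1, hv2⟩ := slice_data hcl hrate hK hs
  exact integral_inner_laplacian_convect_eq_zero_of_det_add_adjoint_eq_zero hsm hdv hB hB₁ hv1 hv2 (hdet s hs)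

/-- The middle principal strain of a `C¹` slice is a continuous function of the point. -/
theorem continuous_midStrain_fderiv {w : EuclideanSpace ℝ (Fin 3) → EuclideanSpace ℝ (Fin 3)}
    (hw : ContDiff ℝ 1 w) :
    Continuous fun y => strainEigenvalues
      (fderiv ℝ w y : EuclideanSpace ℝ (Fin 3) →ₗ[ℝ] EuclideanSpace ℝ (Fin 3)) finrank_euclideanSpace_fin 1 :=
  lipschitzWith_midStrain.continuous.comp (hw.continuous_fderiv (by simp))

/-- From the two-frame form `λ₂ ≤ 0` off the origin to `λ₂ ≤ 0` everywhere, for a `C¹` slice (closedness of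
`{λ₂ ≤ 0}` and density of `{y ≠ 0}`). -/
theorem midStrain_nonpos_of_offOrigin {w : EuclideanSpace ℝ (Fin 3) → EuclideanSpace ℝ (Fin 3)}
    (hw : ContDiff ℝ 1 w)
    (h : ∀ y, y ≠ 0 → ∃ a b : EuclideanSpace ℝ (Fin 3), ‖a‖ = 1 ∧ ‖b‖ = 1 ∧ inner ℝ a b = 0 ∧
      ∀ α β : ℝ, inner ℝ (fderiv ℝ w y (α • a + β • b)) (α • a + β • b) ≤ 0 * (α ^ 2 + β ^ 2)) :
    ∀ y, strainEigenvalues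
      (fderiv ℝ w y : EuclideanSpace ℝ (Fin 3) →ₗ[ℝ] EuclideanSpace ℝ (Fin 3)) finrank_euclideanSpace_fin 1 ≤ 0 := by
  set f : EuclideanSpace ℝ (Fin 3) → ℝ := fun y => strainEigenvalues
      (fderiv ℝ w y : EuclideanSpace ℝ (Fin 3) →ₗ[ℝ] EuclideanSpace ℝ (Fin 3)) finrank_euclideanSpace_fin 1
    with hf
  have hfc : Continuous f := continuous_midStrain_fderiv hw
  have hoff : ∀ y, y ≠ 0 → f y ≤ 0 := by
    intro y hy
    obtain ⟨a, b, ha, hb, hab, hq⟩ := h y hy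
    exact (strainEigenvalues_mid_le_iff
      (fderiv ℝ w y : EuclideanSpace ℝ (Fin 3) →ₗ[ℝ] EuclideanSpace ℝ (Fin 3))
      finrank_euclideanSpace_fin 0).2 ⟨a, b, ha, hb, hab, fun α β => by
        simpa only [ContinuousLinearMap.coe_coe] using hq α β⟩
  have hclosed : IsClosed {y | f y ≤ 0} := isClosed_le hfc continuous_const
  have hsub : ({0}ᶜ : Set (EuclideanSpace ℝ (Fin 3))) ⊆ {y | f y ≤ 0} := fun y hy => hoff y hy
  have hall : closure ({0}ᶜ : Set (EuclideanSpace ℝ (Fin 3))) ⊆ {y | f y ≤ 0} :=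
    hclosed.closure_subset_iff.2 hsub
  rw [(dense_compl_singleton (0 : EuclideanSpace ℝ (Fin 3))).closure_eq] at hall
  exact fun y => hall (mem_univ y)

/-- **support · «tube-strain profile LIOUVILLE»** (text of nsreg-p1 `r15/Sketch16.lean` `TubeStrainProfileLiouville`,
`MidStrainMajorant … 0` unfolded): a door-class profile with space–time Type-I decay whose middle principal strain is
`≤ 0` at every `y ≠ 0` of every slice (two-frame form) vanishes identically — Betchov at the profile level. -/
theorem tubeStrainProfileLiouville :
    ∀ (C D : ℝ) (v : ℝ → EuclideanSpace ℝ (Fin 3) → EuclideanSpace ℝ (Fin 3)),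
    HasTypeITimeDecay C v →
    HasTypeIDecay D v →
    ContinuousOn (Function.uncurry v) (Set.Iio (0 : ℝ) ×ˢ Set.univ) →
    (∀ s t : ℝ, s < t → t < 0 → ∀ x, v t x =
      UnboundedOperators.heatExtension (v s) (t - s) x - oseenDuhamel 1 s v v t x) →
    (∀ t < 0, VectorCalculus.IsDivFree (v t)) →
    (∀ s < 0, ∀ y, y ≠ 0 → ∃ a b : EuclideanSpace ℝ (Fin 3), ‖a‖ = 1 ∧ ‖b‖ = 1 ∧ inner ℝ a b = 0 ∧
      ∀ α β : ℝ, inner ℝ (fderiv ℝ (v s) y (α • a + β • b)) (α • a + β • b) ≤ 0 * (α ^ 2 + β ^ 2)) →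
    ∀ s < 0, ∀ y, v s y = 0 := by
  intro C D v hrate hdec hcont hmild hdiv hmid
  obtain ⟨q, K, hcl, -, hK⟩ := exists_classical_scaleInvariantBounds hrate hdec hcont hmild hdiv
  refine eq_zero_of_integral_inner_laplacian_convect_nonpos hrate hdec hcont hmild hdiv fun s hs => ?_
  obtain ⟨hsm, hdv, hB, hB₁, hv1, hv2⟩ := slice_data hcl hrate hK hs
  exact integral_inner_laplacian_convect_nonpos_of_midStrain_nonpos hsm hdv hB hB₁ hv1 hv2
    (midStrain_nonpos_of_offOrigin (hsm.of_le (by norm_cast)) (hmid s hs))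

/-- **crux (rank 3″) `TubeStrainLiouvilleCore`** (text of nsreg-p1 `r15/Sketch16.lean`, `MidStrainMajorant … 0`
unfolded): the tube-strain Liouville core GIVEN the derivative decay — here a corollary of the unconditional
`tubeStrainProfileLiouville` (the decay hypothesis is not needed: it is `profileGradientDecay`). -/
theorem tubeStrainLiouvilleCore :
    ∀ (C D L : ℝ) (v : ℝ → EuclideanSpace ℝ (Fin 3) → EuclideanSpace ℝ (Fin 3)),
    HasTypeITimeDecay C v →
    HasTypeIDecay D v →
    ContinuousOn (Function.uncurry v) (Set.Iio (0 : ℝ) ×ˢ Set.univ) →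
    (∀ s t : ℝ, s < t → t < 0 → ∀ x, v t x =
      UnboundedOperators.heatExtension (v s) (t - s) x - oseenDuhamel 1 s v v t x) →
    (∀ t < 0, VectorCalculus.IsDivFree (v t)) →
    (∀ s < 0, ∀ y : EuclideanSpace ℝ (Fin 3), ∀ n ≤ 3,
      ‖iteratedFDeriv ℝ n (v s) y‖ ≤ L / (‖y‖ + Real.sqrt (-s)) ^ (n + 1)) →
    (∀ s < 0, ∀ y, y ≠ 0 → ∃ a b : EuclideanSpace ℝ (Fin 3), ‖a‖ = 1 ∧ ‖b‖ = 1 ∧ inner ℝ a b = 0 ∧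
      ∀ α β : ℝ, inner ℝ (fderiv ℝ (v s) y (α • a + β • b)) (α • a + β • b) ≤ 0 * (α ^ 2 + β ^ 2)) →
    ∀ s < 0, ∀ y, v s y = 0 :=
  fun C D _ v hrate hdec hcont hmild hdiv _ hmid =>
    tubeStrainProfileLiouville C D v hrate hdec hcont hmild hdiv hmid

/-- **crux (rank 2″) K2γ `TubeStrainProfileRigidity`** (text of nsreg-p1 `r15/Sketch16.lean`, unfolded): such a
profile is not backward-singular at the apex. -/
theorem tubeStrainProfileRigidity :
    ∀ (C D : ℝ) (v : ℝ → EuclideanSpace ℝ (Fin 3) → EuclideanSpace ℝ (Fin 3)),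
    HasTypeITimeDecay C v →
    HasTypeIDecay D v →
    ContinuousOn (Function.uncurry v) (Set.Iio (0 : ℝ) ×ˢ Set.univ) →
    (∀ s t : ℝ, s < t → t < 0 → ∀ x, v t x =
      UnboundedOperators.heatExtension (v s) (t - s) x - oseenDuhamel 1 s v v t x) →
    (∀ t < 0, VectorCalculus.IsDivFree (v t)) →
    (∀ s < 0, ∀ y, y ≠ 0 → ∃ a b : EuclideanSpace ℝ (Fin 3), ‖a‖ = 1 ∧ ‖b‖ = 1 ∧ inner ℝ a b = 0 ∧
      ∀ α β : ℝ, inner ℝ (fderiv ℝ (v s) y (α • a + β • b)) (α • a + β • b) ≤ 0 * (α ^ 2 + β ^ 2)) →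
    ¬ IsBackwardSingularPoint v 0 :=
  fun C D v hrate hdec hcont hmild hdiv hmid =>
    not_isBackwardSingularPoint_zero_of_forall_eq_zero (tubeStrainProfileLiouville C D v hrate hdec hcont hmild hdiv hmid)

/-- **«production-free profile rigidity», slab form**: with `ω·Sω ≡ 0` on every whole slice the apex is regular. -/
theorem productionFreeProfileRigidity_slab (hrate : HasTypeITimeDecay C v) (hdec : HasTypeIDecay D v)
    (hcont : ContinuousOn (uncurry v) (Iio (0 : ℝ) ×ˢ univ))
    (hmild : ∀ s t : ℝ, s < t → t < 0 → ∀ x,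
      v t x = UnboundedOperators.heatExtension (v s) (t - s) x - oseenDuhamel 1 s v v t x)
    (hdiv : ∀ t < 0, VectorCalculus.IsDivFree (v t))
    (hprod : ∀ s < 0, ∀ z, inner ℝ (curlCLM (fderiv ℝ (v s) z)) ((fderiv ℝ (v s) z) (curlCLM (fderiv ℝ (v s) z))) = 0) :
    ¬ IsBackwardSingularPoint v 0 :=
  not_isBackwardSingularPoint_zero_of_forall_eq_zero
    (productionFreeProfileLiouville C D v hrate hdec hcont hmild hdiv hprod)

/-- **«plane-strain profile rigidity», slab form**: with `det (∇v + ∇vᵀ) ≡ 0` on every whole slice the apex is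
regular. -/
theorem planeStrainProfileRigidity_slab (hrate : HasTypeITimeDecay C v) (hdec : HasTypeIDecay D v)
    (hcont : ContinuousOn (uncurry v) (Iio (0 : ℝ) ×ˢ univ))
    (hmild : ∀ s t : ℝ, s < t → t < 0 → ∀ x,
      v t x = UnboundedOperators.heatExtension (v s) (t - s) x - oseenDuhamel 1 s v v t x)
    (hdiv : ∀ t < 0, VectorCalculus.IsDivFree (v t))
    (hdet : ∀ s < 0, ∀ z, (fderiv ℝ (v s) z + ContinuousLinearMap.adjoint (fderiv ℝ (v s) z)).det = 0) :
    ¬ IsBackwardSingularPoint v 0 :=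
  not_isBackwardSingularPoint_zero_of_forall_eq_zero
    (planeStrainProfileLiouville C D v hrate hdec hcont hmild hdiv hdet)

end Summit.NavierStokesRegularity.NavierStokesRegularity.Theorems.PlaneStrainDoorProfileLiouvilles

end
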